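import Summits.KontsevichZagierPeriods.KontsevichZagierPeriods.Theorems.HurwitzMicroSectorsNormalFormPrincipleM4SimplexFacts
import Literature.NumberTheory.Transcendental.EllIterRepShuffle
import Literature.NumberTheory.Transcendental.KZDominatedFamilyRelations

/-!
# `NormalFormPrinciple` (stmt-KontsevichZagierPeriods-3869), line `SketchIdeator1` —
# leaf `stub_boxRigidity`, layer `M4` toolkit: the shuffle `2 ⊗ 2` as a dissection

Pure proof file (registered sub-goal `m4_prism_shuffle22`, lead seat c9; `--supports` the crux).
Dimension-four toolkit of the leaf: the SHUFFLE PRODUCT of two words of length two read in the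
Kontsevich–Zagier calculus. For a representation `TP` over the prism
`P₂₂ = Δ₂ × Δ₂ = {0 < t₁ < t₀ < 1} × {0 < t₃ < t₂ < 1}` whose integrand agrees there with
`f(t₀) g(t₁) · h(t₂) k(t₃)`, and word representations `W1 … W6` over the decreasing simplex
`Δ₄ = {0 < t₃ < t₂ < t₁ < t₀ < 1}` carrying the six shuffles `fghk, fhgk, fhkg, hfgk, hfkg, hkfg`
of `fg` with `hk`:  `[TP] − [W1] − ⋯ − [W6] ∈ KZ.relations`.
Mechanism: `P₂₂` is, up to the null planes `{t₀ = t₂} ∪ {t₀ = t₃} ∪ {t₁ = t₂} ∪ {t₁ = t₃}`, the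
disjoint union of the six cells "the coordinates in a fixed total order compatible with
`t₀ > t₁`, `t₂ > t₃`" (rule (1a), iterated: `KZ.of_sub_sum_of_mem_relations_of_subset`); each cell
is the preimage of `Δ₄` under a coordinate permutation `e`, over which the restricted `TP` is
congruent to the reindexed word `Wᵢ.reindex e`, itself one change of variables away from `Wᵢ`
(rule (2), `KZ.of_sub_of_reindex_mem_relations`). The statement is generic in the four letters
`f g h k : ℝ → ℝ` (nothing about them is used).
References: M. Kontsevich, D. Zagier, *Periods* (2001), §1.2 rules (1), (2); K. Ihara, M. Kaneko,
D. Zagier, Compos. Math. 142 (2006), §1 (shuffle product of iterated integrals).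
No definitions are introduced.
-/

noncomputable section

open MeasureTheory Set
open Literature.NumberTheory.Transcendental Literature.NumberTheory.Transcendental.KZ
open Literature.ModelTheory.ExponentialFields (IsSemialgebraic)

namespace Summit.KontsevichZagierPeriods.HurwitzMicroSectors.NormalFormPrinciple.PiBox.M3

/-- The cell `{w | w ∘ e ∈ Δ₄}` of a coordinate permutation `e` — the points whose coordinates
taken in the order `e 0, e 1, e 2, e 3` decrease — is `ℚ`-semialgebraic. [cite: KontsevichZagier2001, §1.1] -/
theorem m4q_isSemialgebraic_cell (e : Fin 4 ≃ Fin 4) :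
    IsSemialgebraic ℚ {w : Fin 4 → ℝ | 0 < w (e 3) ∧ w (e 3) < w (e 2) ∧ w (e 2) < w (e 1) ∧
      w (e 1) < w (e 0) ∧ w (e 0) < 1} := by
  have h1 := m4s_isSemialgebraic_setOf_lt 0 (MvPolynomial.X (e 3))
  have h2 := m4s_isSemialgebraic_setOf_lt (MvPolynomial.X (e 3)) (MvPolynomial.X (e 2))
  have h3 := m4s_isSemialgebraic_setOf_lt (MvPolynomial.X (e 2)) (MvPolynomial.X (e 1))
  have h4 := m4s_isSemialgebraic_setOf_lt (MvPolynomial.X (e 1)) (MvPolynomial.X (e 0))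
  have h5 := m4s_isSemialgebraic_setOf_lt (MvPolynomial.X (e 0)) 1
  simp only [MvPolynomial.aeval_X, map_zero, map_one] at h1 h2 h3 h4 h5
  have hP : {w : Fin 4 → ℝ | 0 < w (e 3) ∧ w (e 3) < w (e 2) ∧ w (e 2) < w (e 1) ∧
      w (e 1) < w (e 0) ∧ w (e 0) < 1} =
      {w : Fin 4 → ℝ | 0 < w (e 3)} ∩ {w | w (e 3) < w (e 2)} ∩ {w | w (e 2) < w (e 1)} ∩
        {w | w (e 1) < w (e 0)} ∩ {w | w (e 0) < 1} := by
    ext w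
    simp only [mem_setOf_eq, mem_inter_iff, and_assoc]
  rw [hP]
  exact (((h1.inter h2).inter h3).inter h4).inter h5

/-- **One piece of a shuffle dissection.** If the cell `{w | w ∘ e ∈ Δ₄}` lies in the domain of
`TP` and the integrand of `TP` agrees there with `w ↦ W(w ∘ e)` for a word representation `W`
over `Δ₄`, then `[TP|cell] − [W] ∈ KZ.relations`: the restriction is CONGRUENT to the reindexed
representation `W.reindex e` (same domain, same integrand: `KZ.of_sub_of_mem_relations_of_eqOn`),
which is one coordinate-permutation move away from `W` (`KZ.of_sub_of_reindex_mem_relations`).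
[cite: KontsevichZagier2001, §1.2 rule (2)] -/
theorem m4q_piece (TP W : IntegralRep 4) (e : Fin 4 ≃ Fin 4)
    (hWd : W.domain = {t | 0 < t 3 ∧ t 3 < t 2 ∧ t 2 < t 1 ∧ t 1 < t 0 ∧ t 0 < 1})
    (hsub : {w : Fin 4 → ℝ | 0 < w (e 3) ∧ w (e 3) < w (e 2) ∧ w (e 2) < w (e 1) ∧
      w (e 1) < w (e 0) ∧ w (e 0) < 1} ⊆ TP.domain)
    (hint : ∀ w ∈ {w : Fin 4 → ℝ | 0 < w (e 3) ∧ w (e 3) < w (e 2) ∧ w (e 2) < w (e 1) ∧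
      w (e 1) < w (e 0) ∧ w (e 0) < 1}, TP.integrand w = W.integrand (fun j => w (e j))) :
    of (TP.restrict _ (m4q_isSemialgebraic_cell e) hsub) - of W ∈ relations := by
  have hd : (W.reindex e).domain = (TP.restrict _ (m4q_isSemialgebraic_cell e) hsub).domain := by
    rw [IntegralRep.reindex_domain, hWd, IntegralRep.domain_restrict]
    rfl
  have h1 : of (TP.restrict _ (m4q_isSemialgebraic_cell e) hsub) - of (W.reindex e) ∈ relations :=
    of_sub_of_mem_relations_of_eqOn hd fun w hw => by
      rw [IntegralRep.reindex_integrand]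
      exact hint w hw
  have h2 : of W - of (W.reindex e) ∈ relations := of_sub_of_reindex_mem_relations W e
  have e' : of (TP.restrict _ (m4q_isSemialgebraic_cell e) hsub) - of W =
      (of (TP.restrict _ (m4q_isSemialgebraic_cell e) hsub) - of (W.reindex e)) -
        (of W - of (W.reindex e)) := by abel
  rw [e']
  exact relations.sub_mem h1 h2

/-- The four "tie" planes `{t₀ = t₂} ∪ {t₀ = t₃} ∪ {t₁ = t₂} ∪ {t₁ = t₃}` of `ℝ⁴` form a
Lebesgue-null set. [folklore] -/
theorem m4q_volume_ties :
    volume ({w : Fin 4 → ℝ | w 0 = w 2} ∪ {w | w 0 = w 3} ∪ {w | w 1 = w 2} ∪ {w | w 1 = w 3}) = 0 :=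
  measure_union_null (measure_union_null (measure_union_null
    (volume_setOf_apply_eq_apply (by decide)) (volume_setOf_apply_eq_apply (by decide)))
    (volume_setOf_apply_eq_apply (by decide))) (volume_setOf_apply_eq_apply (by decide))

/-- **Stub (`m4_prism_shuffle22`; registered sub-goal of stmt-KontsevichZagierPeriods-3869, line
`SketchIdeator1`, layer `M4` toolkit).** The shuffle product `(f g) ш (h k)` as a dissection of the
prism `P₂₂ = Δ₂ × Δ₂`: `[TP] − [W1] − [W2] − [W3] − [W4] − [W5] − [W6] ∈ KZ.relations` for the six
shuffles `fghk, fhgk, fhkg, hfgk, hfkg, hkfg` carried by word representations over `Δ₄`.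
[cite: KontsevichZagier2001, §1.2 rules (1), (2)] -/
theorem m4_prism_shuffle22 :
    ∀ (f g h k : ℝ → ℝ) (TP W1 W2 W3 W4 W5 W6 : IntegralRep 4),
      TP.domain = {t | 0 < t 1 ∧ t 1 < t 0 ∧ t 0 < 1 ∧ 0 < t 3 ∧ t 3 < t 2 ∧ t 2 < 1} →
      EqOn TP.integrand (fun t => f (t 0) * g (t 1) * (h (t 2) * k (t 3))) TP.domain →
      W1.domain = {t | 0 < t 3 ∧ t 3 < t 2 ∧ t 2 < t 1 ∧ t 1 < t 0 ∧ t 0 < 1} →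
      EqOn W1.integrand (fun t => f (t 0) * g (t 1) * h (t 2) * k (t 3)) W1.domain →
      W2.domain = {t | 0 < t 3 ∧ t 3 < t 2 ∧ t 2 < t 1 ∧ t 1 < t 0 ∧ t 0 < 1} →
      EqOn W2.integrand (fun t => f (t 0) * h (t 1) * g (t 2) * k (t 3)) W2.domain →
      W3.domain = {t | 0 < t 3 ∧ t 3 < t 2 ∧ t 2 < t 1 ∧ t 1 < t 0 ∧ t 0 < 1} →
      EqOn W3.integrand (fun t => f (t 0) * h (t 1) * k (t 2) * g (t 3)) W3.domain →
      W4.domain = {t | 0 < t 3 ∧ t 3 < t 2 ∧ t 2 < t 1 ∧ t 1 < t 0 ∧ t 0 < 1} →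
      EqOn W4.integrand (fun t => h (t 0) * f (t 1) * g (t 2) * k (t 3)) W4.domain →
      W5.domain = {t | 0 < t 3 ∧ t 3 < t 2 ∧ t 2 < t 1 ∧ t 1 < t 0 ∧ t 0 < 1} →
      EqOn W5.integrand (fun t => h (t 0) * f (t 1) * k (t 2) * g (t 3)) W5.domain →
      W6.domain = {t | 0 < t 3 ∧ t 3 < t 2 ∧ t 2 < t 1 ∧ t 1 < t 0 ∧ t 0 < 1} →
      EqOn W6.integrand (fun t => h (t 0) * k (t 1) * f (t 2) * g (t 3)) W6.domain →
      of TP - of W1 - of W2 - of W3 - of W4 - of W5 - of W6 ∈ relations := by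
  intro f g h k TP W1 W2 W3 W4 W5 W6 hTPd hTPi hW1d hW1i hW2d hW2i hW3d hW3i hW4d hW4i hW5d hW5i
    hW6d hW6i
  -- the six sorting permutations (coordinates listed in decreasing order), with their values
  obtain ⟨e1, a0, a1, a2, a3⟩ : ∃ e : Fin 4 ≃ Fin 4, e 0 = 0 ∧ e 1 = 1 ∧ e 2 = 2 ∧ e 3 = 3 :=
    ⟨Equiv.refl _, rfl, rfl, rfl, rfl⟩
  obtain ⟨e2, b0, b1, b2, b3⟩ : ∃ e : Fin 4 ≃ Fin 4, e 0 = 0 ∧ e 1 = 2 ∧ e 2 = 1 ∧ e 3 = 3 :=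
    ⟨⟨![0, 2, 1, 3], ![0, 2, 1, 3], by decide, by decide⟩, rfl, rfl, rfl, rfl⟩
  obtain ⟨e3, c0, c1, c2, c3⟩ : ∃ e : Fin 4 ≃ Fin 4, e 0 = 0 ∧ e 1 = 2 ∧ e 2 = 3 ∧ e 3 = 1 :=
    ⟨⟨![0, 2, 3, 1], ![0, 3, 1, 2], by decide, by decide⟩, rfl, rfl, rfl, rfl⟩
  obtain ⟨e4, d0, d1, d2, d3⟩ : ∃ e : Fin 4 ≃ Fin 4, e 0 = 2 ∧ e 1 = 0 ∧ e 2 = 1 ∧ e 3 = 3 :=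
    ⟨⟨![2, 0, 1, 3], ![1, 2, 0, 3], by decide, by decide⟩, rfl, rfl, rfl, rfl⟩
  obtain ⟨e5, g0, g1, g2, g3⟩ : ∃ e : Fin 4 ≃ Fin 4, e 0 = 2 ∧ e 1 = 0 ∧ e 2 = 3 ∧ e 3 = 1 :=
    ⟨⟨![2, 0, 3, 1], ![1, 3, 0, 2], by decide, by decide⟩, rfl, rfl, rfl, rfl⟩
  obtain ⟨e6, i0, i1, i2, i3⟩ : ∃ e : Fin 4 ≃ Fin 4, e 0 = 2 ∧ e 1 = 3 ∧ e 2 = 0 ∧ e 3 = 1 :=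
    ⟨⟨![2, 3, 0, 1], ![2, 3, 0, 1], by decide, by decide⟩, rfl, rfl, rfl, rfl⟩
  -- the six cells lie in the prism
  have hsub1 : {w : Fin 4 → ℝ | 0 < w (e1 3) ∧ w (e1 3) < w (e1 2) ∧ w (e1 2) < w (e1 1) ∧
      w (e1 1) < w (e1 0) ∧ w (e1 0) < 1} ⊆ TP.domain := by
    intro w hw
    simp only [mem_setOf_eq, a0, a1, a2, a3] at hw
    rw [hTPd]
    obtain ⟨p1, p2, p3, p4, p5⟩ := hw
    exact ⟨by linarith, p4, p5, p1, p2, by linarith⟩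
  have hsub2 : {w : Fin 4 → ℝ | 0 < w (e2 3) ∧ w (e2 3) < w (e2 2) ∧ w (e2 2) < w (e2 1) ∧
      w (e2 1) < w (e2 0) ∧ w (e2 0) < 1} ⊆ TP.domain := by
    intro w hw
    simp only [mem_setOf_eq, b0, b1, b2, b3] at hw
    rw [hTPd]
    obtain ⟨p1, p2, p3, p4, p5⟩ := hw
    exact ⟨by linarith, by linarith, p5, p1, by linarith, by linarith⟩
  have hsub3 : {w : Fin 4 → ℝ | 0 < w (e3 3) ∧ w (e3 3) < w (e3 2) ∧ w (e3 2) < w (e3 1) ∧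
      w (e3 1) < w (e3 0) ∧ w (e3 0) < 1} ⊆ TP.domain := by
    intro w hw
    simp only [mem_setOf_eq, c0, c1, c2, c3] at hw
    rw [hTPd]
    obtain ⟨p1, p2, p3, p4, p5⟩ := hw
    exact ⟨p1, by linarith, p5, by linarith, p3, by linarith⟩
  have hsub4 : {w : Fin 4 → ℝ | 0 < w (e4 3) ∧ w (e4 3) < w (e4 2) ∧ w (e4 2) < w (e4 1) ∧
      w (e4 1) < w (e4 0) ∧ w (e4 0) < 1} ⊆ TP.domain := by
    intro w hw
    simp only [mem_setOf_eq, d0, d1, d2, d3] at hw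
    rw [hTPd]
    obtain ⟨p1, p2, p3, p4, p5⟩ := hw
    exact ⟨by linarith, p3, by linarith, p1, by linarith, p5⟩
  have hsub5 : {w : Fin 4 → ℝ | 0 < w (e5 3) ∧ w (e5 3) < w (e5 2) ∧ w (e5 2) < w (e5 1) ∧
      w (e5 1) < w (e5 0) ∧ w (e5 0) < 1} ⊆ TP.domain := by
    intro w hw
    simp only [mem_setOf_eq, g0, g1, g2, g3] at hw
    rw [hTPd]
    obtain ⟨p1, p2, p3, p4, p5⟩ := hw
    exact ⟨p1, by linarith, by linarith, by linarith, by linarith, p5⟩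
  have hsub6 : {w : Fin 4 → ℝ | 0 < w (e6 3) ∧ w (e6 3) < w (e6 2) ∧ w (e6 2) < w (e6 1) ∧
      w (e6 1) < w (e6 0) ∧ w (e6 0) < 1} ⊆ TP.domain := by
    intro w hw
    simp only [mem_setOf_eq, i0, i1, i2, i3] at hw
    rw [hTPd]
    obtain ⟨p1, p2, p3, p4, p5⟩ := hw
    exact ⟨p1, p2, by linarith, by linarith, p4, p5⟩
  -- the six pieces `[TP|cellᵢ] − [Wᵢ] ∈ relations`
  have q1 := m4q_piece TP W1 e1 hW1d hsub1 fun w hw => by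
    simp only [mem_setOf_eq, a0, a1, a2, a3] at hw
    obtain ⟨p1, p2, p3, p4, p5⟩ := hw
    have hwD : (fun j => w (e1 j)) ∈ W1.domain := by
      rw [hW1d]; simp only [mem_setOf_eq, a0, a1, a2, a3]; exact ⟨p1, p2, p3, p4, p5⟩
    rw [hTPi (hsub1 (by simp only [mem_setOf_eq, a0, a1, a2, a3]; exact ⟨p1, p2, p3, p4, p5⟩)),
      hW1i hwD]
    simp only [a0, a1, a2, a3]
    ring
  have q2 := m4q_piece TP W2 e2 hW2d hsub2 fun w hw => by
    simp only [mem_setOf_eq, b0, b1, b2, b3] at hw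
    obtain ⟨p1, p2, p3, p4, p5⟩ := hw
    have hwD : (fun j => w (e2 j)) ∈ W2.domain := by
      rw [hW2d]; simp only [mem_setOf_eq, b0, b1, b2, b3]; exact ⟨p1, p2, p3, p4, p5⟩
    rw [hTPi (hsub2 (by simp only [mem_setOf_eq, b0, b1, b2, b3]; exact ⟨p1, p2, p3, p4, p5⟩)),
      hW2i hwD]
    simp only [b0, b1, b2, b3]
    ring
  have q3 := m4q_piece TP W3 e3 hW3d hsub3 fun w hw => by
    simp only [mem_setOf_eq, c0, c1, c2, c3] at hw
    obtain ⟨p1, p2, p3, p4, p5⟩ := hw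
    have hwD : (fun j => w (e3 j)) ∈ W3.domain := by
      rw [hW3d]; simp only [mem_setOf_eq, c0, c1, c2, c3]; exact ⟨p1, p2, p3, p4, p5⟩
    rw [hTPi (hsub3 (by simp only [mem_setOf_eq, c0, c1, c2, c3]; exact ⟨p1, p2, p3, p4, p5⟩)),
      hW3i hwD]
    simp only [c0, c1, c2, c3]
    ring
  have q4 := m4q_piece TP W4 e4 hW4d hsub4 fun w hw => by
    simp only [mem_setOf_eq, d0, d1, d2, d3] at hw
    obtain ⟨p1, p2, p3, p4, p5⟩ := hw
    have hwD : (fun j => w (e4 j)) ∈ W4.domain := by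
      rw [hW4d]; simp only [mem_setOf_eq, d0, d1, d2, d3]; exact ⟨p1, p2, p3, p4, p5⟩
    rw [hTPi (hsub4 (by simp only [mem_setOf_eq, d0, d1, d2, d3]; exact ⟨p1, p2, p3, p4, p5⟩)),
      hW4i hwD]
    simp only [d0, d1, d2, d3]
    ring
  have q5 := m4q_piece TP W5 e5 hW5d hsub5 fun w hw => by
    simp only [mem_setOf_eq, g0, g1, g2, g3] at hw
    obtain ⟨p1, p2, p3, p4, p5⟩ := hw
    have hwD : (fun j => w (e5 j)) ∈ W5.domain := by
      rw [hW5d]; simp only [mem_setOf_eq, g0, g1, g2, g3]; exact ⟨p1, p2, p3, p4, p5⟩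
    rw [hTPi (hsub5 (by simp only [mem_setOf_eq, g0, g1, g2, g3]; exact ⟨p1, p2, p3, p4, p5⟩)),
      hW5i hwD]
    simp only [g0, g1, g2, g3]
    ring
  have q6 := m4q_piece TP W6 e6 hW6d hsub6 fun w hw => by
    simp only [mem_setOf_eq, i0, i1, i2, i3] at hw
    obtain ⟨p1, p2, p3, p4, p5⟩ := hw
    have hwD : (fun j => w (e6 j)) ∈ W6.domain := by
      rw [hW6d]; simp only [mem_setOf_eq, i0, i1, i2, i3]; exact ⟨p1, p2, p3, p4, p5⟩
    rw [hTPi (hsub6 (by simp only [mem_setOf_eq, i0, i1, i2, i3]; exact ⟨p1, p2, p3, p4, p5⟩)),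
      hW6i hwD]
    simp only [i0, i1, i2, i3]
    ring
  -- the restricted pieces as a `Fin 6`-family
  generalize hR1 : TP.restrict _ (m4q_isSemialgebraic_cell e1) hsub1 = R1 at q1
  generalize hR2 : TP.restrict _ (m4q_isSemialgebraic_cell e2) hsub2 = R2 at q2
  generalize hR3 : TP.restrict _ (m4q_isSemialgebraic_cell e3) hsub3 = R3 at q3
  generalize hR4 : TP.restrict _ (m4q_isSemialgebraic_cell e4) hsub4 = R4 at q4
  generalize hR5 : TP.restrict _ (m4q_isSemialgebraic_cell e5) hsub5 = R5 at q5
  generalize hR6 : TP.restrict _ (m4q_isSemialgebraic_cell e6) hsub6 = R6 at q6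
  -- plain-coordinate descriptions of the six domains
  have D1 : ∀ w ∈ R1.domain, 0 < w 3 ∧ w 3 < w 2 ∧ w 2 < w 1 ∧ w 1 < w 0 ∧ w 0 < 1 := by
    intro w hw; rw [← hR1, IntegralRep.domain_restrict] at hw
    simpa only [mem_setOf_eq, a0, a1, a2, a3] using hw
  have D2 : ∀ w ∈ R2.domain, 0 < w 3 ∧ w 3 < w 1 ∧ w 1 < w 2 ∧ w 2 < w 0 ∧ w 0 < 1 := by
    intro w hw; rw [← hR2, IntegralRep.domain_restrict] at hw
    simpa only [mem_setOf_eq, b0, b1, b2, b3] using hw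
  have D3 : ∀ w ∈ R3.domain, 0 < w 1 ∧ w 1 < w 3 ∧ w 3 < w 2 ∧ w 2 < w 0 ∧ w 0 < 1 := by
    intro w hw; rw [← hR3, IntegralRep.domain_restrict] at hw
    simpa only [mem_setOf_eq, c0, c1, c2, c3] using hw
  have D4 : ∀ w ∈ R4.domain, 0 < w 3 ∧ w 3 < w 1 ∧ w 1 < w 0 ∧ w 0 < w 2 ∧ w 2 < 1 := by
    intro w hw; rw [← hR4, IntegralRep.domain_restrict] at hw
    simpa only [mem_setOf_eq, d0, d1, d2, d3] using hw
  have D5 : ∀ w ∈ R5.domain, 0 < w 1 ∧ w 1 < w 3 ∧ w 3 < w 0 ∧ w 0 < w 2 ∧ w 2 < 1 := by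
    intro w hw; rw [← hR5, IntegralRep.domain_restrict] at hw
    simpa only [mem_setOf_eq, g0, g1, g2, g3] using hw
  have D6 : ∀ w ∈ R6.domain, 0 < w 1 ∧ w 1 < w 0 ∧ w 0 < w 3 ∧ w 3 < w 2 ∧ w 2 < 1 := by
    intro w hw; rw [← hR6, IntegralRep.domain_restrict] at hw
    simpa only [mem_setOf_eq, i0, i1, i2, i3] using hw
  -- and conversely
  have M1 : ∀ w : Fin 4 → ℝ, 0 < w 3 → w 3 < w 2 → w 2 < w 1 → w 1 < w 0 → w 0 < 1 → w ∈ R1.domain := by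
    intro w p1 p2 p3 p4 p5; rw [← hR1, IntegralRep.domain_restrict]
    simp only [mem_setOf_eq, a0, a1, a2, a3]; exact ⟨p1, p2, p3, p4, p5⟩
  have M2 : ∀ w : Fin 4 → ℝ, 0 < w 3 → w 3 < w 1 → w 1 < w 2 → w 2 < w 0 → w 0 < 1 → w ∈ R2.domain := by
    intro w p1 p2 p3 p4 p5; rw [← hR2, IntegralRep.domain_restrict]
    simp only [mem_setOf_eq, b0, b1, b2, b3]; exact ⟨p1, p2, p3, p4, p5⟩
  have M3 : ∀ w : Fin 4 → ℝ, 0 < w 1 → w 1 < w 3 → w 3 < w 2 → w 2 < w 0 → w 0 < 1 → w ∈ R3.domain := by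
    intro w p1 p2 p3 p4 p5; rw [← hR3, IntegralRep.domain_restrict]
    simp only [mem_setOf_eq, c0, c1, c2, c3]; exact ⟨p1, p2, p3, p4, p5⟩
  have M4 : ∀ w : Fin 4 → ℝ, 0 < w 3 → w 3 < w 1 → w 1 < w 0 → w 0 < w 2 → w 2 < 1 → w ∈ R4.domain := by
    intro w p1 p2 p3 p4 p5; rw [← hR4, IntegralRep.domain_restrict]
    simp only [mem_setOf_eq, d0, d1, d2, d3]; exact ⟨p1, p2, p3, p4, p5⟩
  have M5 : ∀ w : Fin 4 → ℝ, 0 < w 1 → w 1 < w 3 → w 3 < w 0 → w 0 < w 2 → w 2 < 1 → w ∈ R5.domain := by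
    intro w p1 p2 p3 p4 p5; rw [← hR5, IntegralRep.domain_restrict]
    simp only [mem_setOf_eq, g0, g1, g2, g3]; exact ⟨p1, p2, p3, p4, p5⟩
  have M6 : ∀ w : Fin 4 → ℝ, 0 < w 1 → w 1 < w 0 → w 0 < w 3 → w 3 < w 2 → w 2 < 1 → w ∈ R6.domain := by
    intro w p1 p2 p3 p4 p5; rw [← hR6, IntegralRep.domain_restrict]
    simp only [mem_setOf_eq, i0, i1, i2, i3]; exact ⟨p1, p2, p3, p4, p5⟩
  have hsubR : ∀ i ∈ (Finset.univ : Finset (Fin 6)),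
      ((![R1, R2, R3, R4, R5, R6] : Fin 6 → IntegralRep 4) i).domain ⊆ TP.domain := by
    intro i _
    match i with
    | 0 => rw [← hR1]; exact hsub1
    | 1 => rw [← hR2]; exact hsub2
    | 2 => rw [← hR3]; exact hsub3
    | 3 => rw [← hR4]; exact hsub4
    | 4 => rw [← hR5]; exact hsub5
    | 5 => rw [← hR6]; exact hsub6
  have hintR : ∀ i ∈ (Finset.univ : Finset (Fin 6)),
      EqOn ((![R1, R2, R3, R4, R5, R6] : Fin 6 → IntegralRep 4) i).integrand TP.integrand
        ((![R1, R2, R3, R4, R5, R6] : Fin 6 → IntegralRep 4) i).domain := by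
    intro i _
    match i with
    | 0 => rw [← hR1]; exact fun _ _ => rfl
    | 1 => rw [← hR2]; exact fun _ _ => rfl
    | 2 => rw [← hR3]; exact fun _ _ => rfl
    | 3 => rw [← hR4]; exact fun _ _ => rfl
    | 4 => rw [← hR5]; exact fun _ _ => rfl
    | 5 => rw [← hR6]; exact fun _ _ => rfl
  -- the cells cover the prism off the four tie planes
  have hcov : TP.domain \ ⋃ i ∈ (Finset.univ : Finset (Fin 6)),
      ((![R1, R2, R3, R4, R5, R6] : Fin 6 → IntegralRep 4) i).domain ⊆
      {w : Fin 4 → ℝ | w 0 = w 2} ∪ {w | w 0 = w 3} ∪ {w | w 1 = w 2} ∪ {w | w 1 = w 3} := by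
    rintro w ⟨hwP, hwU⟩
    rw [hTPd] at hwP
    obtain ⟨h1, h10, h0, h3, h32, h2⟩ := hwP
    by_contra hne
    simp only [mem_union, mem_setOf_eq, not_or] at hne
    obtain ⟨⟨⟨n02, n03⟩, n12⟩, n13⟩ := hne
    apply hwU
    simp only [mem_iUnion, Finset.mem_univ, exists_true_left]
    rcases lt_or_gt_of_ne n12 with h12 | h21
    · -- t1 < t2
      rcases lt_or_gt_of_ne n02 with h02 | h20
      · -- t0 < t2 : cells 4, 5, 6 by the position of t3
        rcases lt_or_gt_of_ne n13 with h13' | h31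
        · rcases lt_or_gt_of_ne n03 with h03 | h30
          · exact ⟨5, M6 w h1 h10 h03 h32 h2⟩
          · exact ⟨4, M5 w h1 h13' h30 h02 h2⟩
        · exact ⟨3, M4 w h3 h31 h10 h02 h2⟩
      · -- t2 < t0 : cells 2, 3
        rcases lt_or_gt_of_ne n13 with h13' | h31
        · exact ⟨2, M3 w h1 h13' h32 h20 h0⟩
        · exact ⟨1, M2 w h3 h31 h12 h20 h0⟩
    · -- t2 < t1 : cell 1
      exact ⟨0, M1 w h3 h32 h21 h10 h0⟩
  have hvol : volume (TP.domain \ ⋃ i ∈ (Finset.univ : Finset (Fin 6)),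
      ((![R1, R2, R3, R4, R5, R6] : Fin 6 → IntegralRep 4) i).domain) = 0 :=
    measure_mono_null hcov m4q_volume_ties
  -- the cells are pairwise disjoint
  have hdisj : (↑(Finset.univ : Finset (Fin 6)) : Set (Fin 6)).Pairwise fun i j =>
      Disjoint ((![R1, R2, R3, R4, R5, R6] : Fin 6 → IntegralRep 4) i).domain
        ((![R1, R2, R3, R4, R5, R6] : Fin 6 → IntegralRep 4) j).domain := by
    have key : ∀ i j : Fin 6, i < j → Disjoint ((![R1, R2, R3, R4, R5, R6] : Fin 6 → IntegralRep 4) i).domain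
        ((![R1, R2, R3, R4, R5, R6] : Fin 6 → IntegralRep 4) j).domain := by
      intro i j hij
      refine Set.disjoint_left.2 fun w hw hw' => ?_
      match i, j, hij with
      | 0, 1, _ => obtain ⟨_, u2, u3, _, _⟩ := D1 w hw; obtain ⟨_, v2, v3, _, _⟩ := D2 w hw'; linarith
      | 0, 2, _ => obtain ⟨_, u2, u3, _, _⟩ := D1 w hw; obtain ⟨_, v2, v3, _, _⟩ := D3 w hw'; linarith
      | 0, 3, _ => obtain ⟨_, u2, u3, u4, _⟩ := D1 w hw; obtain ⟨_, v2, v3, v4, _⟩ := D4 w hw'; linarith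
      | 0, 4, _ => obtain ⟨_, u2, u3, u4, _⟩ := D1 w hw; obtain ⟨_, v2, v3, v4, _⟩ := D5 w hw'; linarith
      | 0, 5, _ => obtain ⟨_, u2, u3, u4, _⟩ := D1 w hw; obtain ⟨_, v2, v3, v4, _⟩ := D6 w hw'; linarith
      | 1, 2, _ => obtain ⟨_, u2, u3, u4, _⟩ := D2 w hw; obtain ⟨_, v2, v3, v4, _⟩ := D3 w hw'; linarith
      | 1, 3, _ => obtain ⟨_, u2, u3, u4, _⟩ := D2 w hw; obtain ⟨_, v2, v3, v4, _⟩ := D4 w hw'; linarith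
      | 1, 4, _ => obtain ⟨_, u2, u3, u4, _⟩ := D2 w hw; obtain ⟨_, v2, v3, v4, _⟩ := D5 w hw'; linarith
      | 1, 5, _ => obtain ⟨_, u2, u3, u4, _⟩ := D2 w hw; obtain ⟨_, v2, v3, v4, _⟩ := D6 w hw'; linarith
      | 2, 3, _ => obtain ⟨_, u2, u3, u4, _⟩ := D3 w hw; obtain ⟨_, v2, v3, v4, _⟩ := D4 w hw'; linarith
      | 2, 4, _ => obtain ⟨_, u2, u3, u4, _⟩ := D3 w hw; obtain ⟨_, v2, v3, v4, _⟩ := D5 w hw'; linarith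
      | 2, 5, _ => obtain ⟨_, u2, u3, u4, _⟩ := D3 w hw; obtain ⟨_, v2, v3, v4, _⟩ := D6 w hw'; linarith
      | 3, 4, _ => obtain ⟨_, u2, u3, u4, _⟩ := D4 w hw; obtain ⟨_, v2, v3, v4, _⟩ := D5 w hw'; linarith
      | 3, 5, _ => obtain ⟨_, u2, u3, u4, _⟩ := D4 w hw; obtain ⟨_, v2, v3, v4, _⟩ := D6 w hw'; linarith
      | 4, 5, _ => obtain ⟨_, u2, u3, u4, _⟩ := D5 w hw; obtain ⟨_, v2, v3, v4, _⟩ := D6 w hw'; linarith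
      | 0, 0, hij | 1, 0, hij | 1, 1, hij | 2, 0, hij | 2, 1, hij | 2, 2, hij | 3, 0, hij | 3, 1, hij
      | 3, 2, hij | 3, 3, hij | 4, 0, hij | 4, 1, hij | 4, 2, hij | 4, 3, hij | 4, 4, hij | 5, 0, hij
      | 5, 1, hij | 5, 2, hij | 5, 3, hij | 5, 4, hij | 5, 5, hij => exact absurd hij (by decide)
    intro i _ j _ hij
    rcases lt_or_gt_of_ne hij with hlt | hgt
    · exact key i j hlt
    · exact (key j i hgt).symm
  -- the dissection (rule 1a iterated): `[TP] − ∑ᵢ [Rᵢ] ∈ relations`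
  have hS := of_sub_sum_of_mem_relations_of_subset (Finset.univ : Finset (Fin 6)) TP
    ![R1, R2, R3, R4, R5, R6] hsubR hintR hvol hdisj
  have hsum : ∑ i ∈ (Finset.univ : Finset (Fin 6)),
      of ((![R1, R2, R3, R4, R5, R6] : Fin 6 → IntegralRep 4) i) =
      of R1 + of R2 + of R3 + of R4 + of R5 + of R6 := by
    rw [Fin.sum_univ_six]
    rfl
  rw [hsum] at hS
  have e' : of TP - of W1 - of W2 - of W3 - of W4 - of W5 - of W6 =
      (of TP - (of R1 + of R2 + of R3 + of R4 + of R5 + of R6)) +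
        ((of R1 - of W1) + (of R2 - of W2) + (of R3 - of W3) + (of R4 - of W4) + (of R5 - of W5) +
          (of R6 - of W6)) := by abel
  rw [e']
  exact relations.add_mem hS (relations.add_mem (relations.add_mem (relations.add_mem
    (relations.add_mem (relations.add_mem q1 q2) q3) q4) q5) q6)

end Summit.KontsevichZagierPeriods.HurwitzMicroSectors.NormalFormPrinciple.PiBox.M3
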